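import Literature.NumberTheory.Sieve.GrimmeltMerikoski2025TrivialRange
import Literature.Barriers.Parity.SiegelZeroDichotomyPairHLSmoothSampling
import Mathlib.Analysis.Calculus.IteratedDeriv.Lemmas
import Mathlib.Analysis.Calculus.Deriv.Support
import Mathlib.MeasureTheory.Measure.Haar.NormedSpace
import HarnessLib

/-!
# Grimmelt–Merikoski 2025: Poisson summation on `ℓ` for the smoothed root count

L. Grimmelt, J. Merikoski, *On the greatest prime factor and uniform equidistribution of quadratic
polynomials*, arXiv:2505.00493 [GrimmeltMerikoski2025].  The proof of Theorem 1.4 (§5, p. 13)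
opens with "We may assume that for some small `η > 0` we have `K > X^{1-η}`, since otherwise the
claim is trivial by applying Poisson summation on `ℓ`."  This file PROVES the estimate behind
that sentence for the objects of `GrimmeltMerikoski2025.lean` (`GM2025.rootSum`,
`GM2025.rootDiscrepancy`, admissible weights `GM2025.IsAdmissibleWeight`):

* `GM2025.IsAdmissibleWeight.eq_zero_of_one_lt_abs`, `….iteratedDeriv_eq_zero`,
  `….integral_norm_iteratedDeriv_le`: an admissible weight on `[-1, 1]` and its derivatives of
  order `≤ J` vanish off `[-1, 1]`, so `‖ψ^{(j)}‖_{L¹} ≤ 2B`;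
* `GM2025.IsAdmissibleWeight.norm_tsum_sub_le` — **Poisson summation along a residue class**:
  for `J ≥ 2`, `X, L > 0` and any `r`,
  `|∑_{t ∈ ℤ} ψ((r + Lt)/X) − (X/L) ∫ψ| ≤ 2B (L/X)^{J-1}`
  (the tree's sampling estimate `Literature.Barriers.Parity.TaoTeravainen.norm_tsum_sub_div_integral_le`
  — Mathlib's Poisson summation `Real.tsum_eq_tsum_fourier_of_rpow_decay` plus `J` integrations
  by parts — applied to `u ↦ ψ(u/X)`, with `(π²/3)(2π)^{-J} ≤ 1`);
* `GM2025.rootSum_eq_sum_tsum` — the smoothed root count split into residue classes: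
  `∑_{|ℓ| ≤ ⌈X⌉, k ∣ aℓ²+h} ψ(ℓ/X) = ∑_{ν mod k, aν²+h ≡ 0 (k)} ∑_{t ∈ ℤ} ψ((ν + kt)/X)`;
* `GM2025.norm_rootDiscrepancy_le_of_poisson` — **the discrepancy in the Poisson range**:
  `|∑_{aℓ²+h ≡ 0 (k)} ψ(ℓ/X) − (ϱ_{a,h}(k)/k) X ∫ψ| ≤ 2B ϱ_{a,h}(k) (k/X)^{J-1}`,
  which is `≺≺ X^{-A}` for every `A` once `k ≤ X^{1-η}` and `J ≥ J(A, η)`.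

Theorem 1.4 itself in the range `K ≤ X^{1-η}` is assembled from the last bound in
`GrimmeltMerikoski2025TypeIPoissonRange.lean`; the complementary range is the content of the
paper ([GMtechnical, Thm 2.1], automorphic methods) and is NOT in the tree.

## References

* [GrimmeltMerikoski2025] arXiv:2505.00493, §5, first paragraph (p. 13).
* E. M. Stein, G. Weiss, *Introduction to Fourier Analysis on Euclidean Spaces*, Cor. VII.2.6
  (Poisson summation; Mathlib `Real.tsum_eq_tsum_fourier_of_rpow_decay`).
-/

noncomputable section

namespace Literature.NumberTheory.Sieve

open Finset MeasureTheory
open scoped Real ContDiff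

namespace GM2025

open Literature.Barriers.Parity.TaoTeravainen (norm_tsum_sub_div_integral_le)

/-! ### Admissible weights on `[-1, 1]`: support of the derivatives -/

/-- An admissible weight on `[-1, 1]` vanishes at `u` with `|u| > 1`. [folklore] -/
theorem IsAdmissibleWeight.eq_zero_of_one_lt_abs {ψ : ℝ → ℂ} {J : ℕ} {B : ℝ}
    (hψ : IsAdmissibleWeight ψ (-1) 1 J B) {u : ℝ} (hu : 1 < |u|) : ψ u = 0 := by
  by_contra h
  have h1 := hψ.2.1 u h
  have : |u| ≤ 1 := abs_le.mpr ⟨h1.1, h1.2⟩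
  linarith

/-- An admissible weight on `[-1, 1]` has compact support. [folklore] -/
theorem IsAdmissibleWeight.hasCompactSupport {ψ : ℝ → ℂ} {J : ℕ} {B : ℝ}
    (hψ : IsAdmissibleWeight ψ (-1) 1 J B) : HasCompactSupport ψ :=
  HasCompactSupport.intro isCompact_Icc fun u hu => by
    by_contra h
    exact hu (Set.mem_Icc.mpr (hψ.2.1 u h))

/-- The iterated derivatives of an admissible weight on `[-1, 1]` vanish off `[-1, 1]`
(`tsupport ψ^{(j)} ⊆ tsupport ψ ⊆ [-1, 1]`). [folklore] -/
theorem IsAdmissibleWeight.iteratedDeriv_eq_zero {ψ : ℝ → ℂ} {J : ℕ} {B : ℝ}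
    (hψ : IsAdmissibleWeight ψ (-1) 1 J B) (j : ℕ) {u : ℝ} (hu : u ∉ Set.Icc (-1 : ℝ) 1) :
    iteratedDeriv j ψ u = 0 := by
  have hts : tsupport ψ ⊆ Set.Icc (-1 : ℝ) 1 :=
    closure_minimal (fun v hv => Set.mem_Icc.mpr (hψ.2.1 v hv)) isClosed_Icc
  have htsj : tsupport (iteratedDeriv j ψ) ⊆ Set.Icc (-1 : ℝ) 1 := by
    induction j with
    | zero => rwa [iteratedDeriv_zero]
    | succ j ih => rw [iteratedDeriv_succ]; exact tsupport_deriv_subset.trans ih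
  exact image_eq_zero_of_notMem_tsupport fun h => hu (htsj h)

/-- `‖ψ^{(j)}‖_{L¹} ≤ 2B` for an admissible weight on `[-1, 1]` with derivative bound `B` and
`j ≤ J` (the derivative is bounded by `B` and supported on an interval of length `2`).
[folklore] -/
theorem IsAdmissibleWeight.integral_norm_iteratedDeriv_le {ψ : ℝ → ℂ} {J : ℕ} {B : ℝ}
    (hψ : IsAdmissibleWeight ψ (-1) 1 J B) {j : ℕ} (hj : j ≤ J) :
    ∫ u, ‖iteratedDeriv j ψ u‖ ≤ 2 * B := by
  have hzero : ∀ u, u ∉ Set.Icc (-1 : ℝ) 1 → (‖iteratedDeriv j ψ u‖ : ℝ) = 0 := fun u hu => by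
    rw [hψ.iteratedDeriv_eq_zero j hu, norm_zero]
  rw [← setIntegral_eq_integral_of_forall_compl_eq_zero hzero]
  have h2 : volume.real (Set.Icc (-1 : ℝ) 1) = 2 := by
    rw [Real.volume_real_Icc_of_le (by norm_num)]; norm_num
  have := norm_setIntegral_le_of_norm_le_const (μ := volume) (s := Set.Icc (-1 : ℝ) 1)
    (f := fun u => (‖iteratedDeriv j ψ u‖ : ℝ)) (C := B) measure_Icc_lt_top
    fun u _ => by rw [Real.norm_of_nonneg (norm_nonneg _)]; exact hψ.2.2 j hj u
  rw [h2] at this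
  exact (Real.le_norm_self _).trans (this.trans (le_of_eq (mul_comm _ _)))

/-! ### Poisson summation along a residue class -/

/-- `(π²/3) (2π)^{-J} ≤ 1` for `J ≥ 2`. [folklore] -/
theorem pi_sq_div_three_div_two_pi_pow_le_one {J : ℕ} (hJ : 2 ≤ J) :
    (π ^ 2 / 3) / (2 * π) ^ J ≤ 1 := by
  have hπ : 3 < π := Real.pi_gt_three
  have h1 : (1 : ℝ) ≤ 2 * π := by linarith
  have h2 : (2 * π) ^ 2 ≤ (2 * π) ^ J := pow_le_pow_right₀ h1 hJ
  rw [div_le_one (by positivity)]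
  nlinarith

/-- **Poisson summation along a residue class** for an admissible weight `ψ` on `[-1, 1]` with
derivatives of order `≤ J` bounded by `B`, `J ≥ 2`: for `X > 0`, `L > 0` and any real `r`,
`|∑_{t ∈ ℤ} ψ((r + Lt)/X) − (X/L) ∫ψ| ≤ 2B (L/X)^{J-1}`.
With `L = k`, `r = ν` this reads `∑_{ℓ ≡ ν (mod k)} ψ(ℓ/X) = (X/k) ∫ψ + O(B (k/X)^{J-1})`, the
"trivial by applying Poisson summation on `ℓ`" of [GrimmeltMerikoski2025, §5, first paragraph]:
Poisson summation for `u ↦ ψ(u/X)` along `r + Lℤ`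
(`Literature.Barriers.Parity.TaoTeravainen.norm_tsum_sub_div_integral_le`), where
`∫ψ(u/X) du = X∫ψ`, `‖(ψ(·/X))^{(J)}‖₁ = X^{1-J} ‖ψ^{(J)}‖₁ ≤ 2B X^{1-J}` and
`(π²/3)(2π)^{-J} ≤ 1`. [folklore] -/
theorem IsAdmissibleWeight.norm_tsum_sub_le {ψ : ℝ → ℂ} {J : ℕ} {B : ℝ}
    (hψ : IsAdmissibleWeight ψ (-1) 1 J B) (hJ : 2 ≤ J) {X L : ℝ} (hX : 0 < X) (hL : 0 < L)
    (r : ℝ) :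
    ‖∑' t : ℤ, ψ ((r + L * t) / X) - ((X / L : ℝ) : ℂ) * ∫ u, ψ u‖ ≤
      2 * B * (L / X) ^ (J - 1) := by
  -- the rescaled weight `g(u) = ψ(u/X)`
  set g : ℝ → ℂ := fun u => ψ (X⁻¹ * u) with hg_def
  have hψJ : ContDiff ℝ J ψ := hψ.1.of_le (mod_cast le_top)
  have hg : ContDiff ℝ ∞ g := hψ.1.comp (contDiff_const.mul contDiff_id)
  have hgs : HasCompactSupport g := by
    have e : g = fun u => ψ (X⁻¹ • u) := rfl
    rw [e]
    exact hψ.hasCompactSupport.comp_smul (inv_ne_zero hX.ne')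
  have hmain := norm_tsum_sub_div_integral_le hg hgs hJ hL r
  -- identify the sum, the integral and the derivative norm
  have hsum : ∑' t : ℤ, g (r + L * t) = ∑' t : ℤ, ψ ((r + L * t) / X) :=
    tsum_congr fun t => by simp only [hg_def]; rw [inv_mul_eq_div]
  have hint : ((L⁻¹ : ℝ) : ℂ) * ∫ u, g u = ((X / L : ℝ) : ℂ) * ∫ u, ψ u := by
    simp only [hg_def]
    rw [Measure.integral_comp_inv_mul_left (fun u => ψ u) X, abs_of_pos hX, Complex.real_smul,
      ← mul_assoc]
    push_cast
    rw [div_eq_inv_mul]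
  have hder : ∫ u, ‖iteratedDeriv J g u‖ ≤ (X⁻¹) ^ (J - 1) * (2 * B) := by
    have hd : iteratedDeriv J g = fun u => (X⁻¹) ^ J • iteratedDeriv J ψ (X⁻¹ * u) :=
      iteratedDeriv_comp_const_smul hψJ X⁻¹
    have h1 : ∫ u, ‖iteratedDeriv J g u‖ = (X⁻¹) ^ J * ∫ u, ‖iteratedDeriv J ψ (X⁻¹ * u)‖ := by
      rw [hd, ← integral_const_mul]
      congr 1
      funext u
      rw [norm_smul, norm_pow, Real.norm_of_nonneg (inv_pos.mpr hX).le]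
    rw [h1, Measure.integral_comp_inv_mul_left (fun u => ‖iteratedDeriv J ψ u‖) X,
      abs_of_pos hX, smul_eq_mul]
    have hXJ : (X⁻¹) ^ J * X = (X⁻¹) ^ (J - 1) := by
      obtain ⟨m, rfl⟩ : ∃ m, J = m + 1 := ⟨J - 1, by omega⟩
      rw [Nat.add_sub_cancel, pow_succ, mul_assoc, inv_mul_cancel₀ hX.ne', mul_one]
    calc (X⁻¹) ^ J * (X * ∫ u, ‖iteratedDeriv J ψ u‖)
        = (X⁻¹) ^ (J - 1) * ∫ u, ‖iteratedDeriv J ψ u‖ := by rw [← mul_assoc, hXJ]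
      _ ≤ (X⁻¹) ^ (J - 1) * (2 * B) :=
          mul_le_mul_of_nonneg_left (hψ.integral_norm_iteratedDeriv_le le_rfl) (by positivity)
  have hB0 : 0 ≤ B := hψ.bound_nonneg
  rw [hsum, hint] at hmain
  calc ‖∑' t : ℤ, ψ ((r + L * t) / X) - ((X / L : ℝ) : ℂ) * ∫ u, ψ u‖
      ≤ (π ^ 2 / 3) / (2 * π) ^ J * L ^ (J - 1) * ∫ u, ‖iteratedDeriv J g u‖ := hmain
    _ ≤ 1 * L ^ (J - 1) * ((X⁻¹) ^ (J - 1) * (2 * B)) := by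
        gcongr
        exact pi_sq_div_three_div_two_pi_pow_le_one hJ
    _ = 2 * B * (L / X) ^ (J - 1) := by rw [div_eq_mul_inv, mul_pow]; ring

/-! ### The root sum along residue classes and the Poisson bound for the discrepancy -/

/-- **Splitting the smoothed root count into residue classes**: for `k ≥ 1`, `X > 0` and an
admissible `ψ` on `[-1, 1]`,
`∑_{|ℓ| ≤ ⌈X⌉, k ∣ aℓ²+h} ψ(ℓ/X) = ∑_{0 ≤ ν < k, k ∣ aν²+h} ∑_{t ∈ ℤ} ψ((ν + kt)/X)`
(the window `|ℓ| ≤ ⌈X⌉` contains the support of `ψ(ℓ/X)`; reindex `ℓ = ν + kt`). [folklore] -/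
theorem rootSum_eq_sum_tsum {ψ : ℝ → ℂ} {J : ℕ} {B : ℝ} (hψ : IsAdmissibleWeight ψ (-1) 1 J B)
    (a h : ℕ) {k : ℕ} (hk : 0 < k) {X : ℝ} (hX : 0 < X) :
    rootSum a h k ψ X =
      ∑ ν ∈ (range k).filter (fun ν : ℕ => (k : ℤ) ∣ (a : ℤ) * (ν : ℤ) ^ 2 + (h : ℤ)),
        ∑' t : ℤ, ψ (((ν : ℝ) + (k : ℝ) * (t : ℝ)) / X) := by
  haveI : NeZero k := ⟨hk.ne'⟩
  set G : ℤ → ℂ := fun ℓ => if (k : ℤ) ∣ (a : ℤ) * ℓ ^ 2 + (h : ℤ) then ψ ((ℓ : ℝ) / X) else 0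
    with hG
  -- `G` vanishes outside the window `|ℓ| ≤ ⌈X⌉`
  have hGzero : ∀ ℓ : ℤ, X < |(ℓ : ℝ)| → G ℓ = 0 := by
    intro ℓ hℓ
    simp only [hG]
    split_ifs
    · apply hψ.eq_zero_of_one_lt_abs
      rwa [abs_div, abs_of_pos hX, lt_div_iff₀ hX, one_mul]
    · rfl
  have hwin : ∀ ℓ : ℤ, ℓ ∉ Icc (-⌈X⌉) ⌈X⌉ → G ℓ = 0 := by
    intro ℓ hℓ
    apply hGzero
    rw [mem_Icc, not_and_or, not_le, not_le] at hℓ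
    have hc : X ≤ ((⌈X⌉ : ℤ) : ℝ) := Int.le_ceil X
    rcases hℓ with hℓ | hℓ
    · have : ((ℓ : ℤ) : ℝ) < -((⌈X⌉ : ℤ) : ℝ) := by exact_mod_cast hℓ
      rw [abs_of_neg (by linarith)]; linarith
    · have : ((⌈X⌉ : ℤ) : ℝ) < ((ℓ : ℤ) : ℝ) := by exact_mod_cast hℓ
      have h0 : (0 : ℝ) ≤ ((⌈X⌉ : ℤ) : ℝ) := by exact_mod_cast Int.ceil_nonneg hX.le
      rw [abs_of_pos (by linarith)]; linarith
  have hGs : Summable G := summable_of_ne_finset_zero hwin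
  -- Step 1: the root sum is `∑' G`
  have h1 : rootSum a h k ψ X = ∑' ℓ : ℤ, G ℓ := by
    rw [tsum_eq_sum hwin, rootSum, sum_filter]
  -- Step 2: reindex by `Fin k × ℤ ≃ ℤ`, `(ν, t) ↦ t k + ν`
  set e : Fin k × ℤ ≃ ℤ := (Equiv.prodComm (Fin k) ℤ).trans (Int.divModEquiv k).symm with he
  have he_apply : ∀ (ν : Fin k) (t : ℤ), e (ν, t) = t * (k : ℤ) + ((ν : ℕ) : ℤ) := by
    intro ν t
    simp [he, Int.divModEquiv]
  have h2 : ∑' ℓ : ℤ, G ℓ = ∑' p : Fin k × ℤ, G (e p) := (Equiv.tsum_eq e G).symm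
  have hGes : Summable (G ∘ e) := (Equiv.summable_iff e).mpr hGs
  have h3 : ∑' p : Fin k × ℤ, G (e p) = ∑ ν : Fin k, ∑' t : ℤ, G (e (ν, t)) := by
    rw [← tsum_fintype (L := SummationFilter.unconditional _)]
    exact hGes.tsum_prod
  -- Step 3: on the class of `ν` the divisibility condition does not depend on `t`
  have hdvd : ∀ (ν : Fin k) (t : ℤ),
      ((k : ℤ) ∣ (a : ℤ) * (t * (k : ℤ) + ((ν : ℕ) : ℤ)) ^ 2 + (h : ℤ)) ↔
        ((k : ℤ) ∣ (a : ℤ) * ((ν : ℕ) : ℤ) ^ 2 + (h : ℤ)) := by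
    intro ν t
    have e1 : (a : ℤ) * (t * (k : ℤ) + ((ν : ℕ) : ℤ)) ^ 2 + (h : ℤ) =
        (k : ℤ) * ((a : ℤ) * t * (t * (k : ℤ) + 2 * ((ν : ℕ) : ℤ))) +
          ((a : ℤ) * ((ν : ℕ) : ℤ) ^ 2 + (h : ℤ)) := by ring
    rw [e1]
    exact dvd_add_right (dvd_mul_right _ _)
  set P : ℕ → Prop := fun ν => (k : ℤ) ∣ (a : ℤ) * (ν : ℤ) ^ 2 + (h : ℤ) with hP
  have h4 : ∀ ν : Fin k, ∑' t : ℤ, G (e (ν, t)) =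
      if P (ν : ℕ) then ∑' t : ℤ, ψ ((((ν : ℕ) : ℝ) + (k : ℝ) * (t : ℝ)) / X) else 0 := by
    intro ν
    by_cases hp : P (ν : ℕ)
    · rw [if_pos hp]
      refine tsum_congr fun t => ?_
      rw [he_apply]
      simp only [hG, hdvd ν t]
      rw [if_pos hp]
      congr 1
      push_cast
      ring
    · rw [if_neg hp]
      have : ∀ t : ℤ, G (e (ν, t)) = 0 := fun t => by
        rw [he_apply]
        simp only [hG, hdvd ν t]
        rw [if_neg hp]
      rw [tsum_congr this, tsum_zero]
  rw [h1, h2, h3, Fintype.sum_congr _ _ h4,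
    Fin.sum_univ_eq_sum_range (fun ν : ℕ =>
      if P ν then ∑' t : ℤ, ψ (((ν : ℝ) + (k : ℝ) * (t : ℝ)) / X) else 0) k,
    ← sum_filter]

/-- **The discrepancy in the Poisson range**: for an admissible `ψ` on `[-1, 1]` with
derivatives of order `≤ J` bounded by `B`, `J ≥ 2`, `k ≥ 1` and `X > 0`,
`|∑_{aℓ²+h ≡ 0 (k)} ψ(ℓ/X) − (ϱ_{a,h}(k)/k) X ∫ψ| ≤ 2B ϱ_{a,h}(k) (k/X)^{J-1}`:
each of the `ϱ_{a,h}(k)` root classes `ν (mod k)` contributes `(X/k)∫ψ + O(B (k/X)^{J-1})` by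
`IsAdmissibleWeight.norm_tsum_sub_le`.  For `k ≤ 2X^{1-η}` the bound is
`≤ 2B ϱ(k) (2X^{-η})^{J-1}`, smaller than any fixed power of `X` for `J` large — the "trivial by
applying Poisson summation on `ℓ`" of [GrimmeltMerikoski2025, §5, first paragraph]. [folklore] -/
theorem norm_rootDiscrepancy_le_of_poisson {ψ : ℝ → ℂ} {J : ℕ} {B : ℝ}
    (hψ : IsAdmissibleWeight ψ (-1) 1 J B) (hJ : 2 ≤ J) (a h : ℕ) {k : ℕ} (hk : 0 < k)
    {X : ℝ} (hX : 0 < X) :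
    ‖rootDiscrepancy a h k ψ X‖ ≤ 2 * B * rho a h k * ((k : ℝ) / X) ^ (J - 1) := by
  set R := (range k).filter (fun ν : ℕ => (k : ℤ) ∣ (a : ℤ) * (ν : ℤ) ^ 2 + (h : ℤ)) with hR
  have hρ : rho a h k = #R := rho_eq_card_filter a h k
  have hk0 : (0 : ℝ) < k := Nat.cast_pos.mpr hk
  unfold rootDiscrepancy
  rw [rootSum_eq_sum_tsum hψ a h hk hX]
  have hmain : ((rho a h k : ℂ) / (k : ℂ)) * (X : ℂ) * ∫ u, ψ u =
      ∑ ν ∈ R, ((X / k : ℝ) : ℂ) * ∫ u, ψ u := by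
    rw [sum_const, nsmul_eq_mul, ← hρ]
    push_cast
    ring
  rw [hmain, ← sum_sub_distrib]
  calc ‖∑ ν ∈ R, (∑' t : ℤ, ψ (((ν : ℝ) + (k : ℝ) * (t : ℝ)) / X) -
          ((X / k : ℝ) : ℂ) * ∫ u, ψ u)‖
      ≤ ∑ ν ∈ R, ‖∑' t : ℤ, ψ (((ν : ℝ) + (k : ℝ) * (t : ℝ)) / X) -
          ((X / k : ℝ) : ℂ) * ∫ u, ψ u‖ := norm_sum_le _ _
    _ ≤ ∑ ν ∈ R, 2 * B * ((k : ℝ) / X) ^ (J - 1) :=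
        sum_le_sum fun ν _ => hψ.norm_tsum_sub_le hJ hX hk0 _
    _ = 2 * B * #R * ((k : ℝ) / X) ^ (J - 1) := by
        rw [sum_const, nsmul_eq_mul]; ring
    _ = _ := by rw [hρ]

end GM2025

end Literature.NumberTheory.Sieve

end
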